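import Mathlib
import Summits.KontsevichZagierPeriods.Zeta5Search.DenomLaw.TS3RayCStar
import HarnessLib

/-!
# ζ(5) search — `C⋆` on TOP_STAIR #3, part 2: the top of the profile (`C⋆ ≤ 3, 2, 1, 0` for `p > 35n, 38n, 40n, 43n`)

Cell `pub-zeta5` (HONEST FRAMING: systematic search; no irrationality claim unless certified), TRACK «DENOM-LAW» D1 prover seat
(denom-prover-d1 g14, `HOME/denom-law/prover-d1/ATTEMPT-14.md` §3).  Completes `DenomLaw/TS3RayCStar` (`C⋆ ≤ 10/9/8/6/5` for `p > 25n/…/32n`) with the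
upper cells of the first period of TOP_STAIR #3, `b(n) = n·(85; 35,32,30,27,25,22,20) = bRay ts3 n`, by the same profile wrapper `cStar_ts3_le_of`
(one `decide +kernel` over the 5,040 vertex orderings each): `C⋆ ≤ 3` for `p > 35n` (no parameter reaches `p`; heavy blocks `36n, 38n, 38n, 40n, 43n`),
`≤ 2` for `p > 38n`, `≤ 1` for `p > 40n` (the single block `b₀ − b₆ − b₇ = 43n`), `= 0` for `p > 43n` — so the exact profile of the PATH-accounting datum on
the whole first period reads `11, 11, 10, 9, 8, 6, 5, 3, 2, 1, 0` on `(21.5,23], (23,25], (25,26], (26,28], (28,30], (30,32], (32,35], (35,38], (38,40], (40,43],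
(43,∞)` (all attained: `HOME/…/g14/tables/ts3_cells_n24.txt`).  The PATH value itself only uses `C⋆ ≤ 5` above `32n` (`DenomLaw/TS3RayPath`); these
sharper bounds record the datum exactly.  Pure combinatorics; nothing about ζ(5) or irrationality.
-/

open Finset

namespace Summit.KontsevichZagierPeriods.Zeta5Search.StairTS3

open Summit.KontsevichZagierPeriods.Zeta5Search.DenomLaw (cStar)
open Summit.KontsevichZagierPeriods.Zeta5Search.StaircaseCells (bRay ts3)

/-- **`C⋆ ≤ 3` for `p > 35n`** (attained on `(35n, 38n]`). -/
theorem cStar_ts3_le_three {n p : ℕ} (hp : 35 * n < p) : cStar (bRay ts3 n) p ≤ 3 :=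
  cStar_ts3_le_of hp (by decide +kernel)

/-- **`C⋆ ≤ 2` for `p > 38n`** (attained on `(38n, 40n]`). -/
theorem cStar_ts3_le_two {n p : ℕ} (hp : 38 * n < p) : cStar (bRay ts3 n) p ≤ 2 :=
  cStar_ts3_le_of hp (by decide +kernel)

/-- **`C⋆ ≤ 1` for `p > 40n`** (attained on `(40n, 43n]`: the single heavy block `b₀ − b₆ − b₇ = 43n`). -/
theorem cStar_ts3_le_one {n p : ℕ} (hp : 40 * n < p) : cStar (bRay ts3 n) p ≤ 1 :=
  cStar_ts3_le_of hp (by decide +kernel)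

/-- **`C⋆ = 0` for `p > 43n`** (no parameter and no pair block reaches `p`). -/
theorem cStar_ts3_eq_zero {n p : ℕ} (hp : 43 * n < p) : cStar (bRay ts3 n) p = 0 :=
  Nat.le_zero.1 (cStar_ts3_le_of hp (by decide +kernel))

end Summit.KontsevichZagierPeriods.Zeta5Search.StairTS3
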